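import Summits.HubbardSuperconductivity.HubbardSuperconductivity.Theses.LiebTwin
import Literature.MathematicalPhysics.QuantumLattice.HubbardModel
import Literature.MathematicalPhysics.QuantumLattice.FinDimSpectrum

/-!
# Strategist r1 sketch — typed statements referred to in `Cruxes/DWavePolarisedDiscordance/STRATEGY-CENSUS.md` (r1)

Evidence file (not a tree proposal). Every `def` below is a `Prop` (or an abbreviation used to
state one); nothing is asserted. Namespace is scratch.
-/

noncomputable section
set_option linter.dupNamespace false

namespace Summit.HubbardSuperconductivity.HubbardSuperconductivity.Cruxes.DWavePolarisedDiscordance.StrategistR1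

open Matrix Literature.MathematicalPhysics.QuantumLattice Literature.Probability.LatticeModels
open scoped ComplexOrder MatrixOrder Matrix.Norms.L2Operator

/-- filling `n = ⌊(1-δ)L²/2⌋` -/
abbrev nfill (δ : ℝ) (L : ℕ) : ℕ := ⌊(1 - δ) * (L : ℝ) ^ 2 / 2⌋₊

/-- `F_g(φ) = Re⟨φ, Δ_gᴴ Δ_g φ⟩` -/
def F (g : Site 2 → ℝ) (L : ℕ) [NeZero L] (φ : Fock (Orb (FermionTorus 2 L))) : ℝ :=
  (expect ((pairField g L)ᴴ * pairField g L) φ).re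

/-- the Lieb twin `φ̃ = liebVec n |liebW n φ|` -/
def twin (δ : ℝ) (L : ℕ) [NeZero L] (φ : Fock (Orb (FermionTorus 2 L))) : Fock (Orb (FermionTorus 2 L)) :=
  liebVec (nfill δ L) (CFC.abs (liebW (nfill δ L) φ))

/-- discordance mass `m = F_s(φ̃) − F_s(φ)` -/
def mass (δ : ℝ) (L : ℕ) [NeZero L] (φ : Fock (Orb (FermionTorus 2 L))) : ℝ :=
  F sWave L (twin δ L φ) - F sWave L φ

/-! ## The crux and its two readings (same constants as the route file) -/

/-- K3′ as filed (`Theses.LiebTwin.DWavePolarisedDiscordance`, restated through the abbreviations;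
`k3prime_iff` below is `Iff.rfl`-checkable by `unfold`). -/
def K3prime : Prop :=
  ∀ U ∈ Set.Ioc (0 : ℝ) 4, ∀ δ ∈ Set.Icc (1 / 10 : ℝ) (3 / 10), ∃ κ : ℝ, 0 < κ ∧ ∀ ε : ℝ, 0 < ε →
    ∃ L₀ : ℕ, ∀ (L : ℕ) [NeZero L], L₀ ≤ L → Even L → ∀ φ : Fock (Orb (FermionTorus 2 L)),
      star φ ⬝ᵥ φ = 1 → IsGroundStateInSector (hubbardTorus 2 L 1 U) (2 * nfill δ L) 0 φ →
        κ * mass δ L φ - ε * (L : ℝ) ^ 4 ≤ F dWaveFormFactor L φ - F dWaveFormFactor L (twin δ L φ)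

/-- K3″ (bond locality; = `stub_massFeedsBondSinglets`, what `closes` consumes). -/
def K3bond : Prop :=
  ∀ U ∈ Set.Ioc (0 : ℝ) 4, ∀ δ ∈ Set.Icc (1 / 10 : ℝ) (3 / 10), ∃ κ : ℝ, 0 < κ ∧ ∀ ε : ℝ, 0 < ε →
    ∃ L₀ : ℕ, ∀ (L : ℕ) [NeZero L], L₀ ≤ L → Even L → ∀ φ : Fock (Orb (FermionTorus 2 L)),
      star φ ⬝ᵥ φ = 1 → IsGroundStateInSector (hubbardTorus 2 L 1 U) (2 * nfill δ L) 0 φ →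
        κ * mass δ L φ - ε * (L : ℝ) ^ 4 ≤ F dWaveFormFactor L φ + F extendedSWave L φ

theorem k3prime_iff :
    K3prime ↔ Summit.HubbardSuperconductivity.HubbardSuperconductivity.Theses.LiebTwin.DWavePolarisedDiscordance := by
  unfold K3prime mass F twin nfill Theses.LiebTwin.DWavePolarisedDiscordance
  exact Iff.rfl

/-! ## § Decomposition — the best typed split (assembly proved in
`Theorems/LiebTwinDWavePolarisedDiscordanceSummitSandwich.lean`, θ = 0 instance) -/

/-- Piece B of the split `K3′ ⇐ K3″ ∧ TwinBondFree`: the twin carries no macroscopic d-wave order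
and the state no macroscopic extended-s order (the latter is A1g-slaved onsite order, in-tree under
`NoOnsiteODLRO`; the former is a statement about the TWIN that no engine in the tree or in print
controls — lead c1's 4×4 ED has `F_d(φ̃)/F_d(φ) = 16.3` at `(N,U) = (6,4)`). -/
def TwinBondFree : Prop :=
  ∀ U ∈ Set.Ioc (0 : ℝ) 4, ∀ δ ∈ Set.Icc (1 / 10 : ℝ) (3 / 10), ∀ ε : ℝ, 0 < ε →
    ∃ L₀ : ℕ, ∀ (L : ℕ) [NeZero L], L₀ ≤ L → Even L → ∀ φ : Fock (Orb (FermionTorus 2 L)),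
      star φ ⬝ᵥ φ = 1 → IsGroundStateInSector (hubbardTorus 2 L 1 U) (2 * nfill δ L) 0 φ →
        F extendedSWave L φ + F dWaveFormFactor L (twin δ L φ) ≤ ε * (L : ℝ) ^ 4

/-- The summit matrix asserted UNIFORMLY on the box (hypothesis of
`SummitSandwich.bondLocality_of_uniformBoxDWaveFloor : UniformBoxDWaveFloor → K3bond`). -/
def UniformBoxDWaveFloor : Prop :=
  ∀ U ∈ Set.Ioc (0 : ℝ) 4, ∀ δ ∈ Set.Icc (1 / 10 : ℝ) (3 / 10), ∃ a : ℝ, 0 < a ∧ ∃ L₀ : ℕ,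
    ∀ (L : ℕ) [NeZero L], L₀ ≤ L → Even L → ∀ φ : Fock (Orb (FermionTorus 2 L)), star φ ⬝ᵥ φ = 1 →
      IsGroundStateInSector (hubbardTorus 2 L 1 U) (2 * nfill δ L) 0 φ → a * (L : ℝ) ^ 4 ≤ F dWaveFormFactor L φ

/-! ## § Strengthen — the two candidate rigidifications of minimality, both dead -/

/-- **S⁺_E(C)**: K3′ for every normalised sector state within TOTAL energy `C` of the sector floor
(`C = 0` is K3′ for ground states). Census r1 §Strengthen: at any box point where K2 and the summit floor
hold and connected pair correlations cluster, the charge-twisted ground state `U_θ φ` (θ_x = 2πx₁/L) has excess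
energy ≤ 4π², the SAME twin onsite order (`|liebW(U_θ φ)| = Θᴴ|liebW φ|Θ` is a spin-twisted twin and onsite
singlet pairs are spin-twist invariant), and `F_g(U_θ φ) = L²·S_g(4π/L e₁) + O(L³) = o(L⁴)` for g = s, d, xs,
so S⁺_E(C) fails for every `C > 4π²`; minimality must be used at energy resolution o(1) TOTAL. -/
def SPlusLowEnergy (C : ℝ) : Prop :=
  ∀ U ∈ Set.Ioc (0 : ℝ) 4, ∀ δ ∈ Set.Icc (1 / 10 : ℝ) (3 / 10), ∃ κ : ℝ, 0 < κ ∧ ∀ ε : ℝ, 0 < ε →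
    ∃ L₀ : ℕ, ∀ (L : ℕ) [NeZero L], L₀ ≤ L → Even L → ∀ φ : Fock (Orb (FermionTorus 2 L)),
      star φ ⬝ᵥ φ = 1 → φ ∈ szSector (2 * nfill δ L) 0 →
        (expect (hubbardTorus 2 L 1 U) φ).re ≤
            (hubbardTorus 2 L 1 U).minEnergyOn (szSector (2 * nfill δ L) 0) + C →
          κ * mass δ L φ - ε * (L : ℝ) ^ 4 ≤ F dWaveFormFactor L φ - F dWaveFormFactor L (twin δ L φ)

/-- **S⁺_η**: K3′ for every normalised sector EIGENVECTOR that is a pseudospin lowest weight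
(`η φ = 0`, no on-site pair amplitude) — the exact-symmetry substitute for minimality. Census r1
§Negation/§Strengthen: FALSE, witnessed by the max-spin eigenvector `φ_F = (S⁻)ⁿ|Slater(2n lowest
orbitals)↑⟩/‖·‖` (doublon-free, `η φ_F = 0`, `H φ_F = (Σε_k) φ_F` for every `U`): `F_s = F_d = F_xs = 0`
at `φ_F` while its twin is the shell Dicke state with `F_s(φ̃_F) = 2n(n+1) ≍ (1-δ)²L⁴/2`
(pure-python check L=4,n=2: m = 12 = 2n(n+1), D − D′ = −6.67, D + X = 0; kit job j027801 for n = 3, 4). -/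
def SPlusEta : Prop :=
  ∀ U ∈ Set.Ioc (0 : ℝ) 4, ∀ δ ∈ Set.Icc (1 / 10 : ℝ) (3 / 10), ∃ κ : ℝ, 0 < κ ∧ ∀ ε : ℝ, 0 < ε →
    ∃ L₀ : ℕ, ∀ (L : ℕ) [NeZero L], L₀ ≤ L → Even L → ∀ φ : Fock (Orb (FermionTorus 2 L)),
      star φ ⬝ᵥ φ = 1 → φ ∈ szSector (2 * nfill δ L) 0 →
        (∃ E : ℂ, hubbardTorus 2 L 1 U *ᵥ φ = E • φ) → etaLower torusStagger *ᵥ φ = 0 →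
          κ * mass δ L φ - ε * (L : ℝ) ^ 4 ≤ F dWaveFormFactor L φ - F dWaveFormFactor L (twin δ L φ)

/-- The max-spin witness as a Negative-lemma TARGET for the standing disprover (what j027801 checks
numerically and §Negation derives by hand): K3′'s inequality fails, for every κ > 0, along doublon-free
pseudospin-lowest-weight sector eigenvectors — so any proof of K3′ must use minimality beyond
{eigenvector, η-lowest-weight, no double occupancy}. -/
def MaxSpinWitness : Prop :=
  ∀ δ ∈ Set.Icc (1 / 10 : ℝ) (3 / 10), ∀ U : ℝ, ∀ κ : ℝ, 0 < κ → ∃ ε : ℝ, 0 < ε ∧ ∀ L₀ : ℕ,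
    ∃ (L : ℕ) (_ : NeZero L), L₀ ≤ L ∧ Even L ∧ ∃ φ : Fock (Orb (FermionTorus 2 L)),
      star φ ⬝ᵥ φ = 1 ∧ φ ∈ szSector (2 * nfill δ L) 0 ∧
        (∃ E : ℂ, hubbardTorus 2 L 1 U *ᵥ φ = E • φ) ∧ etaLower torusStagger *ᵥ φ = 0 ∧
          F dWaveFormFactor L φ - F dWaveFormFactor L (twin δ L φ) < κ * mass δ L φ - ε * (L : ℝ) ^ 4 ∧
          F dWaveFormFactor L φ + F extendedSWave L φ < κ * mass δ L φ - ε * (L : ℝ) ^ 4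

theorem not_sPlusEta_of_maxSpinWitness (h : MaxSpinWitness) : ¬ SPlusEta := by
  intro hS
  have hδ : (1 / 10 : ℝ) ∈ Set.Icc (1 / 10 : ℝ) (3 / 10) := ⟨le_rfl, by norm_num⟩
  have hU : (4 : ℝ) ∈ Set.Ioc (0 : ℝ) 4 := ⟨by norm_num, le_rfl⟩
  obtain ⟨κ, hκ, hK⟩ := hS 4 hU (1 / 10) hδ
  obtain ⟨ε, hε, hW⟩ := h (1 / 10) hδ 4 κ hκ
  obtain ⟨L₀, hK⟩ := hK ε hε
  obtain ⟨L, _, hL, hE, φ, hφ, hsec, heig, hη, hlt, -⟩ := hW L₀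
  have := hK L hL hE φ hφ hsec heig hη
  linarith

end Summit.HubbardSuperconductivity.HubbardSuperconductivity.Cruxes.DWavePolarisedDiscordance.StrategistR1

end
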